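import Summits.Ventures.QEC.Census.FoldTowerPlan
import HarnessLib

/-!
# Fold certificate of `[[288,12,18]]` — level-1 file 52: 1 theorem(s) over plan segments (levels 1–3 nested)

Kernel computation only (`decide +kernel`, standard axioms); each theorem's work list is a segment of the plan in
`FoldTowerPlan`; assembled in the closer via `FoldTowerSound`.
-/

set_option maxRecDepth 100000

namespace Summit.Ventures.QEC.Census.Fold.Tower

open Summit.Ventures.QEC.Census Summit.Ventures.QEC.Census.Fold

set_option maxHeartbeats 400000000 in
/-- the 9 level-1 work unit(s) `seg1 1050 9` pass `node1Mod` (est. 131 s). -/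
theorem l1c157 : runPlan node1Mod (seg1 1050 9) = true := by decide +kernel


end Summit.Ventures.QEC.Census.Fold.Tower
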